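import Summits.CriticalPhenomena.Ising3DConformalLimit.Theses.ArmHyperscaling
import HarnessLib

/-!
# Item stmt-CriticalPhenomena-15594 `ArmHyperscaling.U4FromMergingFloor` — proved

Route `ArmHyperscaling` (sub-problem `CriticalPhenomena/Ising3DConformalLimit`), support item (glue,
"provable now"): the lattice MERGING FLOOR (crux `MergingFloor`, item 15592: at one non-coincident
quadruple `x` and one `c > 0`, `c·⟨σ_{[x₀/δ]}σ_{[x₁/δ]}⟩⟨σ_{[x₂/δ]}σ_{[x₃/δ]}⟩ ≤ −U₄^{lat}([x/δ])` for
all small `δ > 0`) forces `U₄ ≢ 0` for EVERY non-degenerate pointwise scaling limit `S` of the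
critical correlations `criticalCorr 3`, whatever the renormalisation `ρ`: multiply the lattice
inequality by `ρ(δ)⁴`, let `δ → 0⁺` at `x` (the four-point function and the three pair products
converge by `HasPointwiseScalingLimit`, all configurations involved being non-coincident), and obtain
`c·S₂(x₀,x₁)·S₂(x₂,x₃) ≤ −U₄^S(x)` with a positive left-hand side by non-degeneracy. This is the limit
passage written inline in the route's deciding theorem `ArmHyperscaling.closes` and in
`Cruxes/IsingEuclidUpgradeR4NonGaussian/Disproof.lean` §C.1 (`of_latticeU4RatioPositive`; a `Cruxes/`
work file, not importable under `Theorems/`), here stated for the item's own signature; the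
positivity hypothesis on `ρ` is not used. The conclusion is item stmt-CriticalPhenomena-0636
`IsingEuclidUpgradeR4NonGaussian` verbatim. [cite: AizenmanDuminilCopinAnnals2021, eq. (3.11)]
-/

namespace Summit.CriticalPhenomena.Ising3DConformalLimit.ArmHyperscalingU4FromMergingFloor

open Literature.Probability.LatticeModels Filter Set
open scoped Topology
open Summit.CriticalPhenomena.Ising3DConformalLimit.Theses.ArmHyperscaling

/-- Two distinct entries of an injective quadruple of points of `ℝ³` form a non-coincident pair
configuration. [folklore] -/
theorem pair_mem_nonCoincident_of_injective {x : Fin 4 → EuclideanSpace ℝ (Fin 3)}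
    (hinj : Function.Injective x) {i j : Fin 4} (hij : i ≠ j) :
    (![x i, x j] : Fin 2 → EuclideanSpace ℝ (Fin 3)) ∈ NonCoincident 3 2 := by
  show Function.Injective _
  intro a b hab
  fin_cases a <;> fin_cases b
  · rfl
  · exact absurd (hinj (by simpa using hab)) hij
  · exact absurd (hinj (by simpa using hab)).symm hij
  · rfl

/-- **Limit passage of the merging floor** (Aizenman–Duminil-Copin 2021, eq. (3.11), passed to the
limit; the mathematical content of item 15594 with its hypotheses explicit and WITHOUT the positivity
of `ρ`): if `MergingFloor` holds and `S` is a pointwise scaling limit of `criticalCorr 3` under some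
renormalisation `ρ` with a non-degenerate two-point function, then `U₄^S(x) ≤ −c·S₂(x₀,x₁)S₂(x₂,x₃) < 0`
at the floor's quadruple `x`, so `HasNontrivialU4 S`. [cite: AizenmanDuminilCopinAnnals2021, eq. (3.11)] -/
theorem hasNontrivialU4_of_mergingFloor (hMF : MergingFloor) (ρ : ℝ → ℝ) (S : CorrFamily 3)
    (hlim : HasPointwiseScalingLimit (criticalCorr 3) ρ S) (hnd : IsNondegenerateTwoPoint S) :
    HasNontrivialU4 S := by
  obtain ⟨x, hx, c, hc, hev⟩ := hMF
  have hinj : Function.Injective x := hx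
  -- pairs of distinct points of `x` are non-coincident 2-configurations
  have hpairNC : ∀ i j : Fin 4, i ≠ j →
      (![x i, x j] : Fin 2 → EuclideanSpace ℝ (Fin 3)) ∈ NonCoincident 3 2 :=
    fun i j hij => pair_mem_nonCoincident_of_injective hinj hij
  -- the renormalised pair correlators converge
  have hpair : ∀ i j : Fin 4, i ≠ j → Tendsto
      (fun δ => ρ δ ^ 2 * criticalCorr 3 2 ![latticeApprox δ (x i), latticeApprox δ (x j)])
      (𝓝[>] (0:ℝ)) (𝓝 (S 2 ![x i, x j])) := by
    intro i j hij
    refine Tendsto.congr (fun δ => ?_) ((hlim 2).tendsto_at (hpairNC i j hij))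
    rw [rescaledCorrelator_apply]
    congr 2
    funext k
    fin_cases k <;> rfl
  -- the renormalised four-point correlator converges
  have h4 : Tendsto (fun δ => ρ δ ^ 4 * criticalCorr 3 4 (fun i => latticeApprox δ (x i)))
      (𝓝[>] (0:ℝ)) (𝓝 (S 4 x)) :=
    Tendsto.congr (fun δ => by rw [rescaledCorrelator_apply]) ((hlim 4).tendsto_at hx)
  -- hence the renormalised lattice Ursell function converges to `U₄^S(x)`
  have hUt : Tendsto (fun δ => ρ δ ^ 4 *
      (criticalCorr 3 4 (fun i => latticeApprox δ (x i)) -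
        (criticalCorr 3 2 ![latticeApprox δ (x 0), latticeApprox δ (x 1)] *
          criticalCorr 3 2 ![latticeApprox δ (x 2), latticeApprox δ (x 3)] +
          criticalCorr 3 2 ![latticeApprox δ (x 0), latticeApprox δ (x 2)] *
          criticalCorr 3 2 ![latticeApprox δ (x 1), latticeApprox δ (x 3)] +
          criticalCorr 3 2 ![latticeApprox δ (x 0), latticeApprox δ (x 3)] *
          criticalCorr 3 2 ![latticeApprox δ (x 1), latticeApprox δ (x 2)])))
      (𝓝[>] (0:ℝ)) (𝓝 (limitConnectedFour S x)) := by
    have h := h4.sub ((((hpair 0 1 (by decide)).mul (hpair 2 3 (by decide))).add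
      ((hpair 0 2 (by decide)).mul (hpair 1 3 (by decide)))).add
      ((hpair 0 3 (by decide)).mul (hpair 1 2 (by decide))))
    have hlim_eq : limitConnectedFour S x =
        S 4 x - (S 2 ![x 0, x 1] * S 2 ![x 2, x 3] + S 2 ![x 0, x 2] * S 2 ![x 1, x 3] +
          S 2 ![x 0, x 3] * S 2 ![x 1, x 2]) := rfl
    rw [hlim_eq]
    refine Tendsto.congr (fun δ => ?_) h
    ring
  -- pass the floor to the limit
  have hB := ((hpair 0 1 (by decide)).mul (hpair 2 3 (by decide))).const_mul c
  have hle : c * (S 2 ![x 0, x 1] * S 2 ![x 2, x 3]) ≤ - limitConnectedFour S x := by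
    refine le_of_tendsto_of_tendsto hB hUt.neg ?_
    filter_upwards [hev] with δ hδ
    have hρ4 : (0:ℝ) ≤ ρ δ ^ 4 := by positivity
    have := mul_le_mul_of_nonneg_left hδ hρ4
    calc c * (ρ δ ^ 2 * criticalCorr 3 2 ![latticeApprox δ (x 0), latticeApprox δ (x 1)] *
          (ρ δ ^ 2 * criticalCorr 3 2 ![latticeApprox δ (x 2), latticeApprox δ (x 3)]))
        = ρ δ ^ 4 * (c * (criticalCorr 3 2 ![latticeApprox δ (x 0), latticeApprox δ (x 1)] *
          criticalCorr 3 2 ![latticeApprox δ (x 2), latticeApprox δ (x 3)])) := by ring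
      _ ≤ ρ δ ^ 4 * (-(criticalCorr 3 4 (fun i => latticeApprox δ (x i)) -
        (criticalCorr 3 2 ![latticeApprox δ (x 0), latticeApprox δ (x 1)] *
          criticalCorr 3 2 ![latticeApprox δ (x 2), latticeApprox δ (x 3)] +
          criticalCorr 3 2 ![latticeApprox δ (x 0), latticeApprox δ (x 2)] *
          criticalCorr 3 2 ![latticeApprox δ (x 1), latticeApprox δ (x 3)] +
          criticalCorr 3 2 ![latticeApprox δ (x 0), latticeApprox δ (x 3)] *
          criticalCorr 3 2 ![latticeApprox δ (x 1), latticeApprox δ (x 2)]))) := this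
      _ = _ := by ring
  have hpos : 0 < c * (S 2 ![x 0, x 1] * S 2 ![x 2, x 3]) :=
    mul_pos hc (mul_pos (hnd _ (hpairNC 0 1 (by decide))) (hnd _ (hpairNC 2 3 (by decide))))
  exact ⟨x, hx, ne_of_lt (by linarith)⟩

/-- **Item stmt-CriticalPhenomena-15594** (exact signature): `ArmHyperscaling.U4FromMergingFloor` —
`MergingFloor →` every non-degenerate pointwise scaling limit `S` of `criticalCorr 3` (any `ρ > 0` on
`(0,1]`) has `HasNontrivialU4 S`. By `hasNontrivialU4_of_mergingFloor` (the positivity of `ρ` is not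
needed). [cite: AizenmanDuminilCopinAnnals2021, eq. (3.11)] -/
theorem u4FromMergingFloor_proof :
    Summit.CriticalPhenomena.Ising3DConformalLimit.Theses.ArmHyperscaling.U4FromMergingFloor := by
  intro hMF ρ S _ hlim hnd
  exact hasNontrivialU4_of_mergingFloor hMF ρ S hlim hnd

end Summit.CriticalPhenomena.Ising3DConformalLimit.ArmHyperscalingU4FromMergingFloor
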